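import Summits.ResolutionOfSingularities.ResolutionOfSingularities.Theorems.FrobeniusLadderFRationalResolutionChartAlgebraFixedPointMembership
import Summits.ResolutionOfSingularities.ResolutionOfSingularities.Theorems.FrobeniusLadderFRationalResolutionChartAlgebraFixedPointDim
import Mathlib.RingTheory.RegularLocalRing.Defs
import HarnessLib

/-!
# Crux `FrobeniusLadder.FRationalResolution` (stmt-ResolutionOfSingularities-15317), line `redirect`,
# stub `stub_diagonalizableQuotientResolution` — **embedding dimension at the torus-fixed point: the
# regularity test for the blown-up charts** (point-blow-up recursion for the surface case over arbitrary
# fields, memo MEMO-15317-leafhand2-g6 §3–§4)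

A local-algebra lemma and its chart-algebra instance.

* `linearIndependent_toCotangent_of_forall_not_mem` — in a local ring `R`, elements `x₁, …, x_m ∈ 𝔪`
  none of which lies in `(x_j : j ≠ i) + 𝔪²` have linearly independent images in the cotangent space
  `𝔪/𝔪²`; hence (`card_le_finrank_cotangentSpace_of_forall_not_mem`) `m ≤ dim_κ 𝔪/𝔪²`, and
  (`not_isRegularLocalRing_of_lt_card`) `R` is NOT regular if `dim R < m`.
* **`card_le_finrank_cotangentSpace_fixedPrime`**, **`not_isRegularLocalRing_fixedPrime`** — at the
  torus-fixed prime `𝔓` of a chart algebra `C = A[χ(Q)]` over a point `𝔭` of zero-dimensional log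
  stratum of a log regular chart `φ` (so `𝔪_{C_𝔓} = I(𝔓, χ)`, `…ChartAlgebraFixedPointDim`), a finite
  set `H ⊆ Q ∖ L` of monomials which are IRREDUCIBLE modulo the unit face (`h ∉ h' + Q + L` for
  `h ≠ h' ∈ H`, and `h ∉ (Q ∖ L) + (Q ∖ L) + Q + L`) — e.g. the Hilbert basis of `Q/(Q ∩ L)` — gives
  `#H` linearly independent cotangent vectors `χ(h)`, by the combinatorial monomial membership at `𝔓`
  (`…ChartAlgebraFixedPointMembership`); so `#H ≤ edim C_𝔓`, and **`C_𝔓` is singular as soon as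
  `dim C_𝔓 < #H`**. With `dim C_𝔓₀ ≤ dim A_𝔭` (`…ChartAlgebraFixedPointDim`) this is the test used by
  the surface recursion: the fixed point of an interior chart with three Hilbert-basis elements over a
  surface point is singular.

Honest label: generic local algebra toward ONE leaf stub (no stub, crux or summit closed). No definitions,
no named facts, no sorry. [cite: Kato1994, (6.1), (10.1)] [cite: Niziol2006, Lemma 2.4]
-/

noncomputable section

-- single-problem summit: the doubled namespace component is forced
set_option linter.dupNamespace false

open IsLocalRing Literature.AlgebraicGeometry.Resolution Literature.AlgebraicGeometry.Resolution.LogChart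
open Summit.ResolutionOfSingularities.ResolutionOfSingularities.Theorems.FRationalResolution.ChartAlgebraNormalForm
open Summit.ResolutionOfSingularities.ResolutionOfSingularities.Theorems.FRationalResolution.ChartAlgebraFixedPoint
open Summit.ResolutionOfSingularities.ResolutionOfSingularities.Theorems.FRationalResolution.ChartAlgebraFixedPointMembership
open Summit.ResolutionOfSingularities.ResolutionOfSingularities.Theorems.FRationalResolution.ChartAlgebraFixedPointDim

namespace Summit.ResolutionOfSingularities.ResolutionOfSingularities.Theorems.FRationalResolution.ChartAlgebraFixedPointEmbdim

universe u

/-! ### Local algebra: independent cotangent vectors -/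

/-- **Independent cotangent vectors.** In a local ring `R`, if `x : ι → R` takes values in `𝔪` and
no `x i` lies in `(x j : j ≠ i) + 𝔪²`, then the images of the `x i` in `𝔪/𝔪²` are linearly
independent over the residue field. [folklore] -/
theorem linearIndependent_toCotangent_of_forall_not_mem {R : Type u} [CommRing R] [IsLocalRing R]
    {ι : Type*} (x : ι → R) (hx : ∀ i, x i ∈ maximalIdeal R)
    (hind : ∀ i, x i ∉ Ideal.span (x '' {j | j ≠ i}) ⊔ (maximalIdeal R) ^ 2) :
    LinearIndependent (ResidueField R)
      (fun i => (maximalIdeal R).toCotangent ⟨x i, hx i⟩ : ι → CotangentSpace R) := by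
  classical
  rw [linearIndependent_iff']
  intro s g hsum i hi
  by_contra hgi
  -- lift the coefficients
  have hlift : ∀ j, ∃ c : R, residue R c = g j := fun j => residue_surjective (g j)
  choose c hc using hlift
  have hsum' : (maximalIdeal R).toCotangent (∑ j ∈ s, c j • (⟨x j, hx j⟩ : maximalIdeal R)) = 0 := by
    rw [map_sum]
    rw [← hsum]
    refine Finset.sum_congr rfl fun j _ => ?_
    rw [map_smul, ← hc j]
    exact (algebraMap_smul (ResidueField R) (c j) _).symm
  rw [Ideal.toCotangent_eq_zero] at hsum'
  have hcoe : ((∑ j ∈ s, c j • (⟨x j, hx j⟩ : maximalIdeal R) : maximalIdeal R) : R) =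
      ∑ j ∈ s, c j * x j := by
    rw [AddSubmonoidClass.coe_finsetSum]
    refine Finset.sum_congr rfl fun j _ => ?_
    rfl
  rw [hcoe] at hsum'
  -- `c i` is a unit
  have hu : IsUnit (c i) := by
    rw [← residue_ne_zero_iff_isUnit, hc i]
    exact hgi
  apply hind i
  -- `x i = (c i)⁻¹ (∑ − ∑_{j ≠ i})`
  have hsplit : c i * x i = ∑ j ∈ s, c j * x j - ∑ j ∈ s.erase i, c j * x j := by
    rw [← Finset.add_sum_erase s _ hi, add_sub_cancel_right]
  have hxi : x i = ↑hu.unit⁻¹ * (∑ j ∈ s, c j * x j - ∑ j ∈ s.erase i, c j * x j) := by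
    rw [← hsplit, ← mul_assoc, IsUnit.val_inv_mul, one_mul]
  rw [hxi]
  refine Ideal.mul_mem_left _ _ (Ideal.sub_mem _ (Ideal.mem_sup_right hsum') (Ideal.mem_sup_left ?_))
  refine Ideal.sum_mem _ fun j hj => Ideal.mul_mem_left _ _ (Ideal.subset_span ⟨j, ?_, rfl⟩)
  exact Finset.ne_of_mem_erase hj

/-- Hence `#ι ≤ dim_κ 𝔪/𝔪²` for such a family in a Noetherian local ring. [folklore] -/
theorem card_le_finrank_cotangentSpace_of_forall_not_mem {R : Type u} [CommRing R] [IsLocalRing R]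
    [IsNoetherianRing R] {ι : Type*} [Fintype ι] (x : ι → R) (hx : ∀ i, x i ∈ maximalIdeal R)
    (hind : ∀ i, x i ∉ Ideal.span (x '' {j | j ≠ i}) ⊔ (maximalIdeal R) ^ 2) :
    Fintype.card ι ≤ Module.finrank (ResidueField R) (CotangentSpace R) :=
  (linearIndependent_toCotangent_of_forall_not_mem x hx hind).fintype_card_le_finrank

/-- And `R` is not a regular local ring if its dimension is smaller than `#ι`. [folklore] -/
theorem not_isRegularLocalRing_of_lt_card {R : Type u} [CommRing R] [IsLocalRing R]
    [IsNoetherianRing R] {ι : Type*} [Fintype ι] (x : ι → R) (hx : ∀ i, x i ∈ maximalIdeal R)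
    (hind : ∀ i, x i ∉ Ideal.span (x '' {j | j ≠ i}) ⊔ (maximalIdeal R) ^ 2)
    (hdim : ringKrullDim R < (Fintype.card ι : ℕ)) : ¬ IsRegularLocalRing R := by
  intro hR
  have h1 := (IsRegularLocalRing.iff_finrank_cotangentSpace R).1 hR
  have h2 := card_le_finrank_cotangentSpace_of_forall_not_mem x hx hind
  rw [← h1] at hdim
  exact absurd (lt_of_lt_of_le hdim (by exact_mod_cast h2)) (lt_irrefl _)

/-! ### The test at the torus-fixed prime -/

variable {A : Type u} [CommRing A] {n : ℕ} {P : AddSubmonoid (Fin n → ℤ)} {φ : Multiplicative P →* A}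
  {𝔭 : Ideal A} [𝔭.IsPrime] {C : Type u} [CommRing C] [Algebra A C] {Q : AddSubmonoid (Fin n → ℤ)}
  {χ : Multiplicative Q →* C}

/-- **Irreducible monomials give independent cotangent vectors at the fixed point.** Let `𝔓` be the
torus-fixed prime of the chart algebra `C = A[χ(Q)]` over a point `𝔭` of zero-dimensional stratum of
the log regular chart `φ` (hypotheses of `…ChartAlgebraFixedPointMembership` and `𝔭A_𝔭 ≤ I(𝔭, φ)A_𝔭`),
and `H ⊆ Q ∖ L` a finite set of monomials irreducible modulo the unit face: `h − h' ∉ Q + L` for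
`h ≠ h'` in `H` and `h ∉ q₁ + q₂ + Q + L` for `q₁, q₂ ∈ Q ∖ L`. Then `#H ≤ dim_κ 𝔪_{C_𝔓}/𝔪_{C_𝔓}²`.
[cite: Kato1994, (6.1), (10.1)] -/
theorem card_le_finrank_cotangentSpace_fixedPrime [IsNoetherianRing A] [IsNoetherianRing C] (hP : P.FG)
    (hsat : ∀ (v : Fin n → ℤ) (k : ℕ), 0 < k → k • v ∈ P → v ∈ P) (hreg : IsLogRegularAt P φ 𝔭)
    (hPQ : P ≤ Q)
    (hχ : ∀ p : P, χ (Multiplicative.ofAdd ⟨(p : Fin n → ℤ), hPQ p.2⟩) =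
      algebraMap A C (φ (Multiplicative.ofAdd p)))
    (hgen : Algebra.adjoin A (Set.range χ) = ⊤)
    (hD : ∀ q ∈ Q, ∃ p ∈ P, q + p ∈ P)
    (hK : ∀ a : A, algebraMap A C a = 0 → ∃ p : P, φ (Multiplicative.ofAdd p) * a = 0)
    (hS : ∀ q₁ ∈ Q, ∀ q₂ ∈ Q, q₁ + q₂ ∈ Submodule.span ℤ (faceMonoid P φ 𝔭 : Set (Fin n → ℤ)) →
      q₁ ∈ Submodule.span ℤ (faceMonoid P φ 𝔭 : Set (Fin n → ℤ)))
    {𝔓 : Ideal C} [𝔓.IsPrime] (h𝔓 : 𝔓.comap (algebraMap A C) = 𝔭)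
    (hq : ∀ q : Q, (q : Fin n → ℤ) ∉ Submodule.span ℤ (faceMonoid P φ 𝔭 : Set (Fin n → ℤ)) →
      χ (Multiplicative.ofAdd q) ∈ 𝔓)
    (h0 : maximalIdeal (Localization.AtPrime 𝔭) ≤
      (ideal P φ 𝔭).map (algebraMap A (Localization.AtPrime 𝔭)))
    (H : Finset Q)
    (hHL : ∀ h ∈ H, (h : Fin n → ℤ) ∉ Submodule.span ℤ (faceMonoid P φ 𝔭 : Set (Fin n → ℤ)))
    (hirr₁ : ∀ h ∈ H, ∀ h' ∈ H, h ≠ h' → ∀ s : Q,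
      (h : Fin n → ℤ) - h' - s ∉ Submodule.span ℤ (faceMonoid P φ 𝔭 : Set (Fin n → ℤ)))
    (hirr₂ : ∀ h ∈ H, ∀ q₁ ∈ Q, ∀ q₂ ∈ Q,
      q₁ ∉ Submodule.span ℤ (faceMonoid P φ 𝔭 : Set (Fin n → ℤ)) →
      q₂ ∉ Submodule.span ℤ (faceMonoid P φ 𝔭 : Set (Fin n → ℤ)) → ∀ s : Q,
      (h : Fin n → ℤ) - (q₁ + q₂) - s ∉ Submodule.span ℤ (faceMonoid P φ 𝔭 : Set (Fin n → ℤ))) :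
    H.card ≤ Module.finrank (ResidueField (Localization.AtPrime 𝔓))
      (CotangentSpace (Localization.AtPrime 𝔓)) := by
  classical
  haveI : IsNoetherianRing (Localization.AtPrime 𝔓) :=
    IsLocalization.isNoetherianRing 𝔓.primeCompl (Localization.AtPrime 𝔓) inferInstance
  set f := algebraMap C (Localization.AtPrime 𝔓) with hfdef
  let x : ↥H → Localization.AtPrime 𝔓 := fun h => f (χ (Multiplicative.ofAdd (h : Q)))
  have hx : ∀ h : ↥H, x h ∈ maximalIdeal (Localization.AtPrime 𝔓) := by
    intro h
    rw [← Localization.AtPrime.map_eq_maximalIdeal]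
    exact Ideal.mem_map_of_mem _ (hq _ (hHL _ h.2))
  rw [← Fintype.card_coe H]
  refine card_le_finrank_cotangentSpace_of_forall_not_mem x hx fun h₀ hmem => ?_
  -- the ideal `(x h : h ≠ h₀) + 𝔪²` lies in the ideal generated by `χ(W)`
  set W : Set Q := ((H : Set Q) \ {(h₀ : Q)}) ∪
    {w : Q | ∃ q₁ : Q, ∃ q₂ : Q, (q₁ : Fin n → ℤ) ∉ Submodule.span ℤ (faceMonoid P φ 𝔭 : Set (Fin n → ℤ)) ∧
      (q₂ : Fin n → ℤ) ∉ Submodule.span ℤ (faceMonoid P φ 𝔭 : Set (Fin n → ℤ)) ∧ w = q₁ + q₂} with hWdef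
  have hmax : maximalIdeal (Localization.AtPrime 𝔓) = (ideal Q χ 𝔓).map f :=
    maximalIdeal_eq_map_ideal_of_fixedPrime hPQ hχ hgen hS h𝔓 hq h0
  have hle : Ideal.span (x '' {j | j ≠ h₀}) ⊔ (maximalIdeal (Localization.AtPrime 𝔓)) ^ 2 ≤
      Ideal.span ((fun w : Q => f (χ (Multiplicative.ofAdd w))) '' W) := by
    refine sup_le ?_ ?_
    · refine Ideal.span_mono ?_
      rintro _ ⟨j, hj, rfl⟩
      refine ⟨(j : Q), Or.inl ⟨j.2, ?_⟩, rfl⟩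
      intro hj0
      exact hj (Subtype.ext hj0)
    · rw [hmax, ← Ideal.map_pow, ideal, pow_two, Ideal.span_mul_span', Ideal.map_span, Ideal.span_le]
      rintro _ ⟨_, ⟨_, ⟨q₁, hq₁, rfl⟩, _, ⟨q₂, hq₂, rfl⟩, rfl⟩, rfl⟩
      have hq₁L := (not_mem_iff_mem_span_of_comap_eq hPQ hχ h𝔓 hq q₁).not.1 (not_not.2 hq₁)
      have hq₂L := (not_mem_iff_mem_span_of_comap_eq hPQ hχ h𝔓 hq q₂).not.1 (not_not.2 hq₂)
      refine Ideal.subset_span ⟨q₁ + q₂, Or.inr ⟨q₁, q₂, hq₁L, hq₂L, rfl⟩, ?_⟩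
      change f (χ (Multiplicative.ofAdd (q₁ + q₂))) = f (χ (Multiplicative.ofAdd q₁) * χ (Multiplicative.ofAdd q₂))
      rw [ofAdd_add, map_mul]
  have hmem' := hle hmem
  obtain ⟨w, hw, s, hs⟩ := exists_sub_sub_mem_span_of_mem_span_fixedPrime hP hsat hreg hPQ hχ hgen hD hK hS
    h𝔓 hq (h₀ : Q) W hmem'
  rcases hw with ⟨hwH, hw0⟩ | ⟨q₁, q₂, hq₁L, hq₂L, rfl⟩
  · refine hirr₁ _ h₀.2 _ hwH ?_ s hs
    intro he
    exact hw0 he.symm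
  · exact hirr₂ _ h₀.2 _ q₁.2 _ q₂.2 hq₁L hq₂L s (by simpa using hs)

/-- **The regularity test at the fixed point**: under the hypotheses of
`card_le_finrank_cotangentSpace_fixedPrime`, if `dim C_𝔓 < #H` then `C_𝔓` is not a regular local
ring. (Surface recursion: over a surface point `dim C_𝔓₀ ≤ 2`, so an interior chart whose sharp chart
monoid has three Hilbert-basis elements has a SINGULAR fixed point.) [cite: Kato1994, (6.1), (10.1)] -/
theorem not_isRegularLocalRing_fixedPrime [IsNoetherianRing A] [IsNoetherianRing C] (hP : P.FG)
    (hsat : ∀ (v : Fin n → ℤ) (k : ℕ), 0 < k → k • v ∈ P → v ∈ P) (hreg : IsLogRegularAt P φ 𝔭)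
    (hPQ : P ≤ Q)
    (hχ : ∀ p : P, χ (Multiplicative.ofAdd ⟨(p : Fin n → ℤ), hPQ p.2⟩) =
      algebraMap A C (φ (Multiplicative.ofAdd p)))
    (hgen : Algebra.adjoin A (Set.range χ) = ⊤)
    (hD : ∀ q ∈ Q, ∃ p ∈ P, q + p ∈ P)
    (hK : ∀ a : A, algebraMap A C a = 0 → ∃ p : P, φ (Multiplicative.ofAdd p) * a = 0)
    (hS : ∀ q₁ ∈ Q, ∀ q₂ ∈ Q, q₁ + q₂ ∈ Submodule.span ℤ (faceMonoid P φ 𝔭 : Set (Fin n → ℤ)) →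
      q₁ ∈ Submodule.span ℤ (faceMonoid P φ 𝔭 : Set (Fin n → ℤ)))
    {𝔓 : Ideal C} [𝔓.IsPrime] (h𝔓 : 𝔓.comap (algebraMap A C) = 𝔭)
    (hq : ∀ q : Q, (q : Fin n → ℤ) ∉ Submodule.span ℤ (faceMonoid P φ 𝔭 : Set (Fin n → ℤ)) →
      χ (Multiplicative.ofAdd q) ∈ 𝔓)
    (h0 : maximalIdeal (Localization.AtPrime 𝔭) ≤
      (ideal P φ 𝔭).map (algebraMap A (Localization.AtPrime 𝔭)))
    (H : Finset Q)
    (hHL : ∀ h ∈ H, (h : Fin n → ℤ) ∉ Submodule.span ℤ (faceMonoid P φ 𝔭 : Set (Fin n → ℤ)))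
    (hirr₁ : ∀ h ∈ H, ∀ h' ∈ H, h ≠ h' → ∀ s : Q,
      (h : Fin n → ℤ) - h' - s ∉ Submodule.span ℤ (faceMonoid P φ 𝔭 : Set (Fin n → ℤ)))
    (hirr₂ : ∀ h ∈ H, ∀ q₁ ∈ Q, ∀ q₂ ∈ Q,
      q₁ ∉ Submodule.span ℤ (faceMonoid P φ 𝔭 : Set (Fin n → ℤ)) →
      q₂ ∉ Submodule.span ℤ (faceMonoid P φ 𝔭 : Set (Fin n → ℤ)) → ∀ s : Q,
      (h : Fin n → ℤ) - (q₁ + q₂) - s ∉ Submodule.span ℤ (faceMonoid P φ 𝔭 : Set (Fin n → ℤ)))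
    (hdim : ringKrullDim (Localization.AtPrime 𝔓) < (H.card : ℕ)) :
    ¬ IsRegularLocalRing (Localization.AtPrime 𝔓) := by
  haveI : IsNoetherianRing (Localization.AtPrime 𝔓) :=
    IsLocalization.isNoetherianRing 𝔓.primeCompl (Localization.AtPrime 𝔓) inferInstance
  intro hR
  have h1 := (IsRegularLocalRing.iff_finrank_cotangentSpace (Localization.AtPrime 𝔓)).1 hR
  have h2 := card_le_finrank_cotangentSpace_fixedPrime hP hsat hreg hPQ hχ hgen hD hK hS h𝔓 hq h0 H
    hHL hirr₁ hirr₂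
  rw [← h1] at hdim
  exact absurd (lt_of_lt_of_le hdim (by exact_mod_cast h2)) (lt_irrefl _)

end Summit.ResolutionOfSingularities.ResolutionOfSingularities.Theorems.FRationalResolution.ChartAlgebraFixedPointEmbdim

end
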